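import Summits.ValiantsHypothesis.ValiantsHypothesis.Theorems.VPBoundarySquareNbCollapseIff
import HarnessLib

/-!
# `\overline{VNP}_ε ∩ p-fam ⊆ VNPnb` over `ℂ` and `U_ε^Σ ↔ B_nb` (route `VPBoundarySquare`)

FILE S2 of O-L3-14 «`B_nb` is the GRH-slot» (decomp-valiant lens 3; aside `B_nb` = item 23487 =
`VNPnbPFamSubsetVNP ℂ`). BDS 2024 Lemma 4.1 is printed for a SINGLE presenting polynomial
(`\overline{VP}_ε`); the tree has it as `IsPresVPBarFamily.isVNPnbFamily`. Here the same exponential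
interpolation is run THROUGH a Boolean sum (`\overline{VNP}_ε`, BDS 2024 §1.2 / Dutta–Lysikov Def. 49):

* §1 `presents_boolSum_of_presentsSum`: a presentation through a Boolean sum `Σ_a H(x,a,ε)` is a
  presentation (to the same order) by the ε-free Boolean sum `G = Σ_a H(x,a,ε) ∈ F[x, ε]`
  (definitional bookkeeping: `PresentsSum` l.193 vs `Presents` l.106 of `BDS24PresentableBorder`).
* §2 `interpolant_boolSum`: the BDS interpolant of `G` IS the Boolean sum (over `a`) of the
  interpolant of `H` — the selector products do not involve `a`; hence (§3) the witness
  `(a, e) ↦ N⁻¹ · Π_j(1 + e_j(ω^{(N-M)2^j} - 1)) · H(x, a, Π_j(1 + e_j(ω^{2^j} - 1)))` of size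
  `≤ L(H) + 6t + 2`, `t = L(H) + 1`, whose Boolean sum over `(a, e) ∈ {0,1}^{m+t}` is `f`.
* §3 **T3** `isVNPnbFamily_of_isPresVNPBarFamily`: `\overline{VNP}_ε ∩ {p-families} ⊆ VNPnb^ℂ`;
  hence `presVNPBarSubsetVNP_iff_booleanNbDefinable : PresVNPBarSubsetVNP ℂ ↔ B_nb` (`U_ε^Σ ≡ B_nb`:
  the presentable-`VNP` debordering question over `ℂ` (BDS 2024 §6, open over `ℚ`) and Bürgisser's
  Boolean-part question `VNPnb ∩ p-fam ⊆ VNP` are ONE statement), and the F1c biconditional reads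
  `VNPnb^ℂ ⊆ VPnb^ℂ ↔ (VP ℂ = VNP ℂ ∧ PresVNPBarSubsetVNP ℂ)`.

No `Prop` definitions; nothing constant-free; `B_nb` / `U_ε^Σ` stay OPEN; no tag moves; `VP ≠ VNP`
is not proved by anything here.

References: [BhargavDwivediSaxena2024, Lemma 4.1 (p. 13), §1.2 (p. 5), Thm. 1.3, §6 (p. 16)];
[Burgisser2024Completeness, §4.2 Thm. 4.10 (2) (p0017)]; [Burgisser2000, Def. 2.5, Rem. 2.2].
-/

set_option linter.dupNamespace false

noncomputable section

open MvPolynomial Finset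
open Literature.Computability.AlgebraicComplexity
open Summit.ValiantsHypothesis.ValiantsHypothesis.Theorems.VPBoundarySquareNbBitSplit
open Summit.ValiantsHypothesis.ValiantsHypothesis.Theorems.VPBoundarySquareNbGRHSlot
open Summit.ValiantsHypothesis.ValiantsHypothesis.Theorems.VPBoundarySquareNbCollapseIff

namespace Summit.ValiantsHypothesis.ValiantsHypothesis.Theorems.VPBoundarySquareNbPresSigma

universe u v

section Algebra

variable {F : Type u} [Field F] {σ : Type v} {m : ℕ}

/-! ### §1 A presentation through a Boolean sum is a presentation by the ε-free Boolean sum -/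

/-- `Σ_a H(x, a, ε)` presents `f` to order `M` iff the polynomial `G(x, ε) := Σ_a H(x, a, ε)`
(Boolean sum taken in `F[x, ε]`, the variable `ε` moved out of the summation block by the renaming
`Option (σ ⊕ Fin m) → Option σ ⊕ Fin m`) does: change of scalars and the substitution `ε ↦ ε`
commute with the Boolean sum. [cite: BhargavDwivediSaxena2024, §1.2 (p. 5) with Def. 4.3] -/
theorem presents_boolSum_of_presentsSum {M : ℕ} {H : MvPolynomial (Option (σ ⊕ Fin m)) F}
    {f : MvPolynomial σ F} (h : PresentsSum M H f) :
    Presents M (boolSum (rename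
      (fun o : Option (σ ⊕ Fin m) => o.elim (Sum.inl none) (Sum.map some id)) H)) f := by
  unfold PresentsSum at h
  unfold Presents
  -- change of scalars commutes with the Boolean sum
  have hmap : ∀ g : MvPolynomial (Option σ ⊕ Fin m) F,
      MvPolynomial.map (algebraMap F (LaurentSeries F)) (boolSum g) =
        boolSum (MvPolynomial.map (algebraMap F (LaurentSeries F)) g) := fun g => by
    unfold boolSum
    rw [map_sum]
    refine sum_congr rfl fun e _ => ?_
    show MvPolynomial.map _ (bind₁ _ g) = bind₁ _ (MvPolynomial.map _ g)
    rw [map_bind₁]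
    exact congrArg (fun θ : Option σ ⊕ Fin m → MvPolynomial (Option σ) (LaurentSeries F) =>
        bind₁ θ (MvPolynomial.map (algebraMap F (LaurentSeries F)) g))
      (funext fun i => by
        rcases i with x | j
        · simp
        · by_cases hj : e j <;> simp [hj])
  have hθ : (Sum.elim (fun w : Option σ => rename Sum.inl (epsSubst F σ w))
        (fun j : Fin m => (X (Sum.inr j) : MvPolynomial (σ ⊕ Fin m) (LaurentSeries F)))) ∘
      (fun o : Option (σ ⊕ Fin m) => o.elim (Sum.inl none) (Sum.map some id)) =
      epsSubst F (σ ⊕ Fin m) := by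
    funext o
    rcases o with _ | ⟨x | j⟩ <;> simp [epsSubst, Option.elim, rename_X]
  rw [hmap, ← boolSum_aeval_extend, map_rename, aeval_rename, hθ]
  exact h

/-! ### §2 The interpolant of a Boolean sum is the Boolean sum of the interpolants -/

/-- The selector product renamed into the larger variable set (it involves the selector variables
only). [cite: BhargavDwivediSaxena2024, §1.3 (p. 10)] -/
theorem rename_selPow_eq {t : ℕ} (c : F) :
    rename (Sum.elim (Sum.map (Sum.inl : σ → σ ⊕ Fin t) (id : Fin m → Fin m))
        (fun j : Fin t => (Sum.inl (Sum.inr j) : (σ ⊕ Fin t) ⊕ Fin m)))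
      (selPow (σ := σ ⊕ Fin m) c t) =
    rename (Sum.inl : σ ⊕ Fin t → (σ ⊕ Fin t) ⊕ Fin m) (selPow (σ := σ) c t) := by
  unfold selPow
  rw [map_prod, map_prod]
  exact prod_congr rfl fun j _ => by simp [rename_X]

/-- **The interpolant commutes with the Boolean sum**: for `G = Σ_a H(x, a, ε)`,
`interpolant(G)(x, e) = Σ_a interpolant(H)(x, a, e)` (after moving the block `a` outermost), since
`N⁻¹`, the selector products and the substitution `ε ↦ Π_j(1 + e_j(ω^{2^j} - 1))` do not involve `a`.
[cite: BhargavDwivediSaxena2024, Lemma 4.1 (p. 13)] -/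
theorem interpolant_boolSum (ω : F) (N M t : ℕ) (H : MvPolynomial (Option (σ ⊕ Fin m)) F) :
    interpolant ω N M t (boolSum (rename
      (fun o : Option (σ ⊕ Fin m) => o.elim (Sum.inl none) (Sum.map some id)) H)) =
    boolSum (rename (Sum.elim (Sum.map (Sum.inl : σ → σ ⊕ Fin t) (id : Fin m → Fin m))
        (fun j : Fin t => (Sum.inl (Sum.inr j) : (σ ⊕ Fin t) ⊕ Fin m)))
      (interpolant ω N M t H)) := by
  unfold interpolant
  rw [map_mul, map_mul, rename_C, rename_selPow_eq, boolSum_C_mul', mul_comm (rename Sum.inl _) _,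
    boolSum_mul_rename_inl, mul_comm _ (selPow _ t), ← boolSum_aeval_extend, aeval_rename,
    comp_aeval_apply]
  refine congrArg (fun q : Option (σ ⊕ Fin m) → MvPolynomial ((σ ⊕ Fin t) ⊕ Fin m) F =>
    C ((N : F)⁻¹) * (selPow (ω ^ (N - M)) t * boolSum (aeval q H))) (funext fun o => ?_)
  rcases o with _ | ⟨x | j⟩
  · exact (rename_selPow_eq (σ := σ) (m := m) (t := t) ω).symm
  · simp [Option.elim, rename_X]
  · simp [Option.elim, rename_X]

/-- Degree of the ε-free Boolean sum in `ε`: at most `deg H ≤ 2^{L(H)}`. [folklore] -/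
theorem degreeOf_none_boolSum_le [Fintype σ] (H : MvPolynomial (Option (σ ⊕ Fin m)) F) :
    (boolSum (rename (fun o : Option (σ ⊕ Fin m) => o.elim (Sum.inl none) (Sum.map some id))
      H)).degreeOf none ≤ 2 ^ complexity H :=
  (degreeOf_le_totalDegree _ _).trans ((totalDegree_boolSum_le _).trans
    ((totalDegree_rename_le _ _).trans (totalDegree_le_two_pow_complexity H)))

end Algebra

/-! ### §3 `\overline{VNP}_ε ∩ {p-families} ⊆ VNPnb` -/

section Families

variable {F : Type u} [Field F] {ς : ℕ → Type v} [∀ n, Fintype (ς n)]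

/-- **`\overline{VNP}_ε ∩ {p-families} ⊆ VNPnb`** over a field with primitive `2^t`-th roots of
unity for every `t`: for `f_n ≠ 0` presented through `Σ_a H_n(x, a, ε)` to order `M_n`, with
`t_n = L(H_n) + 1` (so `2^{t_n} > deg_ε Σ_a H_n ≥ M_n`), the Boolean sum over `(a, e) ∈ {0,1}^{u_n + t_n}`
of the interpolant of `H_n` (size `≤ L(H_n) + 6 t_n + 2`) is `f_n`; for `f_n = 0` the zero witness.
[cite: BhargavDwivediSaxena2024, Lemma 4.1 (p. 13), §1.2 (p. 5)] -/
theorem isVNPnbFamily_of_isPresVNPBarFamily_of_primitiveRoots {f : ∀ n, MvPolynomial (ς n) F}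
    (ω : ℕ → F) (hω : ∀ t, IsPrimitiveRoot (ω t) (2 ^ t))
    (hpf : IsPFamily f) (hf : IsPresVNPBarFamily f) : IsVNPnbFamily f := by
  classical
  obtain ⟨u, M, H, hu, hH, hP⟩ := hf
  let t : ℕ → ℕ := fun n => complexity (H n) + 1
  have ht : IsPBounded t := IsPBounded.add_holds hH (IsPBounded.const 1)
  -- the witness: the interpolant of `H n`, blocks reordered to `ς n ⊕ Fin (t n + u n)`
  refine ⟨fun n => t n + u n, fun n => if f n = 0 then 0 else
    rename ((Equiv.sumAssoc (ς n) (Fin (t n)) (Fin (u n))).trans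
        (Equiv.sumCongr (Equiv.refl (ς n)) finSumFinEquiv))
      (rename (Sum.elim (Sum.map (Sum.inl : ς n → ς n ⊕ Fin (t n)) (id : Fin (u n) → Fin (u n)))
          (fun j : Fin (t n) => (Sum.inl (Sum.inr j) : (ς n ⊕ Fin (t n)) ⊕ Fin (u n))))
        (interpolant (ω (t n)) (2 ^ t n) (M n) (t n) (H n))), ?_, fun n => ?_⟩
  · rw [isVPnbFamily_iff_isPComputable]
    refine ⟨(IsPBounded.add_holds hpf.1 (IsPBounded.add_holds ht hu)).mono fun n => by
      simp [Fintype.card_sum], ?_⟩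
    refine (IsPBounded.add_holds (IsPBounded.add_holds hH
      (IsPBounded.mul_holds (IsPBounded.const 6) ht)) (IsPBounded.const 2)).mono fun n => ?_
    dsimp only
    split_ifs with h0
    · rw [← C_0, complexity_C_holds]
      exact Nat.zero_le _
    · exact (complexity_rename_le_holds' _ _).trans ((complexity_rename_le_holds' _ _).trans
        (complexity_interpolant_le _ _ _ _ _))
  · dsimp only
    split_ifs with h0
    · rw [h0]
      simp [boolSum]
    · have hP' := presents_boolSum_of_presentsSum (hP n)
      have hdeg : _ < 2 ^ t n := (degreeOf_none_boolSum_le (H n)).trans_lt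
        (Nat.pow_lt_pow_right (by norm_num) (Nat.lt_succ_self (complexity (H n))))
      rw [← boolSum_boolSum, ← interpolant_boolSum]
      exact (boolSum_interpolant (hω (t n)) hP' hdeg
        ((hP'.le_degreeOf_none h0).trans_lt hdeg)).symm

/-- **T3.** `\overline{VNP}_ε ∩ {p-families} ⊆ VNPnb^ℂ` (primitive roots of unity of every order
exist in `ℂ`). [cite: BhargavDwivediSaxena2024, Lemma 4.1 (p. 13), §1.2 (p. 5)] -/
theorem isVNPnbFamily_of_isPresVNPBarFamily {f : ∀ n, MvPolynomial (ς n) ℂ}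
    (hpf : IsPFamily f) (hf : IsPresVNPBarFamily f) : IsVNPnbFamily f :=
  isVNPnbFamily_of_isPresVNPBarFamily_of_primitiveRoots
    (fun t => Complex.exp (2 * Real.pi * Complex.I / ((2 ^ t : ℕ) : ℂ)))
    (fun t => Complex.isPrimitiveRoot_exp (2 ^ t) (pow_ne_zero t two_ne_zero)) hpf hf

/-- Over `ℂ`, for p-families, `\overline{VNP}_ε = VNPnb` as family predicates.
[cite: BhargavDwivediSaxena2024, Lemma 4.1 (p. 13), §1.2 (p. 5)] -/
theorem isPresVNPBarFamily_iff_isVNPnbFamily {f : ∀ n, MvPolynomial (ς n) ℂ} (hpf : IsPFamily f) :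
    IsPresVNPBarFamily f ↔ IsVNPnbFamily f :=
  ⟨fun hf => isVNPnbFamily_of_isPresVNPBarFamily hpf hf, fun hf => hf.isPresVNPBarFamily⟩

/-- **`U_ε^Σ ≡ B_nb` over `ℂ`**: `\overline{VNP}_ε ⊆ VNP` (p-families; BDS 2024 Thm. 1.3 over finite
fields, OPEN over `ℚ`, §6) `↔` `VNPnb ∩ {p-families} ⊆ VNP` (Bürgisser 2024 §4.2's Boolean-part slot).
[cite: BhargavDwivediSaxena2024, Thm. 1.3 and §6 (p. 16)] -/
theorem presVNPBarSubsetVNP_iff_booleanNbDefinable :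
    PresVNPBarSubsetVNP ℂ ↔ VNPnbPFamSubsetVNP ℂ :=
  ⟨vnpnbPFamSubsetVNP_of_presVNPBarSubsetVNP,
    fun hB v f hpf hf => hB v f hpf (isVNPnbFamily_of_isPresVNPBarFamily hpf hf)⟩

/-- The F1c biconditional with the slot read as presentable debordering:
`VNPnb^ℂ ⊆ VPnb^ℂ ↔ (VP ℂ = VNP ℂ ∧ \overline{VNP}_ε ⊆ VNP over ℂ)`.
[cite: Burgisser2024Completeness, Thm. 4.10 (2) (p0017)] -/
theorem nbCollapse_iff_collapse_and_presVNPBarSubsetVNP :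
    (∀ (v : ℕ → ℕ) (f : ∀ n, MvPolynomial (Fin (v n)) ℂ), IsVNPnbFamily f → IsVPnbFamily f) ↔
      (VP ℂ = VNP ℂ ∧ PresVNPBarSubsetVNP ℂ) := by
  rw [presVNPBarSubsetVNP_iff_booleanNbDefinable]
  exact nbCollapse_iff

end Families

end Summit.ValiantsHypothesis.ValiantsHypothesis.Theorems.VPBoundarySquareNbPresSigma

end
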